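/-
Copyright: the b2b-balaban T⁴-continuum CRUX team, row NE7b leaf lineage `t4-ne7b-formalise-leaf-05` (gen 158). Project licence.
-/
import Summits.QuantumFields.BalabanUV.T4Continuum.Spine.NE7b.AdmissibleFloorSeminormTerms

/-!
# THE SEMINORM-IMS FLOOR FOR TWO FAMILIES OF TERMS — `…AdmissibleFloorSeminormIMS` ∕ `…AdmissibleFloorSeminormTerms` with the IMS error letter
# ADDITIVE OVER THE FAMILIES: the full form `F ⊇ Σ_{j∈J₁} Φ¹_j(x)² + Σ_{j∈J₂} Φ²_j(x)²` (curl terms AND block-average terms), each family with ITS OWN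
# bookkeeping letters `(ℓ_i, λ_i, μ_i, a_i, b_i)`, gives the floor `((c_loc − (1+t⁻¹)(ε₁ + ε₂))∕(1+t))·N(x) ≤ F(x)` on `good`, `ε_i = μ_iℓ_i²λ_i²a_ib_i`
# (row NE7b, node U5c; residual (R2′) family (2), letter (ℓ1); junction lemmas — the located ask of leaf-02 g134's `AVERAGE-TERMS-DESIGN-g134.md` §2 (ii))

Cell `pub-balaban`, sub-cell `t4`, spine estimate NE7b (`T4WeightBudget.RelWeightBound`; the cell's OWN estimate — NOT PRINTED in [Bałaban 1983–89],
NOT PROVED).  Crux-route work under `Spine/NE7b/`; NOTHING of Bałaban's is asserted; no `def`; zero `sorry`; no `T4Continuum/Support` leaf (FREEZE (0)).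
Import: this lineage's `…AdmissibleFloorSeminormTerms` (AFST; it re-exports AFSI `…AdmissibleFloorSeminormIMS`: §2 `ims_floor_of_commutator`, §5
`norm_term_cutoff_le`, `ims_error_of_letters`; AFST §1 `sum_normSq_cutoff`).

WHY.  At `k = 1` the (h2) slot's full form is `F_V^{full}(B′) = L^{d−2}Σ_c|(Q₁(V)B′)(c)|² + Σ_P|(∂_V B′)(P)|²` (`HOME/b2b-balaban-r1/SectE-interface-proof.md`
§5.5): TWO families of linear local terms on the same bond field — the plaquette curls (`#inc = 4`, each bond in `2(d−1)` plaquettes, `ℓ = 1`, term diameter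
`1`) and the next-level block averages (`#inc = L^{d+1}`, each bond in `L` averages, `ℓ = L^{−d∕2−2}` with the weight inside the square, diameter `(d+1)(L−1)`).
The flat floor (B6 Lemma 2.4: `c‖Y‖² ≤ L^{d−2}|QY|² + |∂Y|²`) needs BOTH families, so the local floors — hence the IMS commutator step — must carry both.  AFST
`ims_floor_of_linear_terms` takes ONE uniform `(ℓ, a, b, λ, μ)`; feeding both families under a common `max` over-counts the error `ε = μℓ²λ²ab` by the factor
`L^{d+1}·L` at `ℓ = 1` (leaf-02 g134, `AVERAGE-TERMS-DESIGN-g134.md` §2 (ii): «the right statement is a TWO-FAMILY AFST: `ε = ε_curl + ε_avg` with separate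
letters … located for the AFST author»).  THIS FILE is that statement: AFSI's `ims_floor_of_commutator` is additive in the term index, so on the index
`J₁ ⊕ J₂` the error letter is `ε₁ + ε₂` with each `ε_i` discharged by AFSI §5 from its own family's five counts — the same bookkeeping twice, nothing else.

WHAT IS PROVED ([folklore]):
* §1 **`ims_floor_of_commutator_two`** — AFSI §2 for two families of square-root functionals `Φ¹ : J₁ → E → ℝ`, `Φ² : J₂ → E → ℝ` with their own reference
  weights `w¹, w²` (`Σ_s w_s(j)² ≤ 1`), commutator letters (comm₁)∕(comm₂) and error letters `Σ_{j,s}(ρ¹)² ≤ ε₁N`, `Σ_{j,s}(ρ²)² ≤ ε₂N` on `good`; size `N`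
  split by the localisation; local floors `c_loc·N(loc_s x) ≤ Σ_jΦ¹_j(loc_s x)² + Σ_jΦ²_j(loc_s x)²` for `good x`; `Σ_jΦ¹_j(x)² + Σ_jΦ²_j(x)² ≤ F(x)` on `good`
  ⊢ `((c_loc − (1+t⁻¹)(ε₁ + ε₂))∕(1+t))·N(x) ≤ F(x)` (`ims_floor_of_commutator` on `J₁ ⊕ J₂` with `Sum.elim`, sums split by `Fintype.sum_sum_type`);
  `ims_floor_of_commutator_two_of_left` — the same when the local floors are stated for the first family alone (`Φ² ≥ 0` pads them).
* §2 **`ims_floor_of_linear_terms_two`** — bond fields `x : C → W`, terms `T¹_j x = Σ_{c∈inc₁ j} R¹_{j,c}(x c)` into `V₁` and `T²_j x = Σ_{c∈inc₂ j} R²_{j,c}(x c)`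
  into `V₂` (real-linear, `‖R^i_{j,c}v‖ ≤ ℓ_i‖v‖`), ONE quadratic partition of unity `h` acting by scalars (`Σ_s h_s(c)² = 1`) read with per-family (Lip) `λ_i`
  and (mult) `μ_i`, per-family counts `#inc_i j ≤ a_i`, `#{j : c ∈ inc_i j} ≤ b_i` ⊢
  `((c_loc − (1+t⁻¹)·(μ₁ℓ₁²λ₁²a₁b₁ + μ₂ℓ₂²λ₂²a₂b₂))∕(1+t))·Σ_c‖x c‖² ≤ F x` on `good` — §1 with (comm_i) := `norm_term_cutoff_le`, (err_i) := `ims_error_of_letters`,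
  (part) := `sum_normSq_cutoff`.
* §3 **`admissible_floor_linear_terms_two`** — the same with the local floors PRODUCED per cube from the five letters (iso)∕(cov)∕(adm)∕(pert)∕(flat) of AFSI
  §3–§4, (cov) now reading `Σ_j‖T¹_j(h_s•x)‖² + Σ_j‖T²_j(h_s•x)‖² = F′_s(u_s(h_s•x))` (`c_loc = c∕2 − δ`).
* §4 (`example`) — AFST `ims_floor_of_linear_terms` RECOVERED as the case `J₂ = Empty` (consistency check in the kernel, `ε₂`'s counts all `0`; no declaration);
  §5 toy: two one-term families on one bond, `R = id` on `ℝ`, `h ≡ 1` (`λ_i = 0`): `((2 − 2·(0 + 0))∕2)·‖x‖² ≤ 2‖x‖²` (`example`).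

NOT HERE (honest): the lattice data BY VALUE — which typed operator is «`Q₁(V)` on the unit torus» ((A3) ∕ OWNER), the average terms' incidence `ιA`, counts
`a₂ = L^{d+1}`, `b₂ = L`, displacement `D₂ = (d+1)(L−1)` and (Lip) `λ₂` (leaf-02's lattice-geometry lane, `AVERAGE-TERMS-DESIGN-g134.md` §3), the average-part
(pert) letter, the flat floor in the chosen currency (Q-leaf05-g157-1); (A1c); NC-NE7b-α UNRULED.  BY-NAME EFFECT ON THE WALL: NONE (the (h2) skeleton admits the
full form's two families; the wall is (R2)).  NE7b NOT PRINTED ∕ NOT PROVED; spine PROVED 0∕9; rung (B)+1 on ONE finite T⁴ — NOT infinite volume, NOT the mass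
gap, NOT Clay.
HONEST DEPENDENCY: continuum YM on T⁴ ⇐ BetaPertH ∧ nine spine estimates (0/9 proved); BetaPertH ⇐ (D1) ∧ (D4) ∧ CAP+tail; G-an2-4 gates asym, D1 and NE2/3/4.
-/

set_option autoImplicit false

noncomputable section

open Finset
open Summit.QuantumFields.BalabanUV.T4Continuum.NE7b.AdmissibleFloorSeminormIMS
  (ims_floor_of_commutator norm_term_cutoff_le ims_error_of_letters)
open Summit.QuantumFields.BalabanUV.T4Continuum.NE7b.AdmissibleFloorSeminormTerms (sum_normSq_cutoff ims_floor_of_linear_terms)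

namespace Summit.QuantumFields.BalabanUV.T4Continuum.NE7b.AdmissibleFloorSeminormTwoFamilies

/-! ## §1 IMS floor for two families of square-root functionals (AFSI §2 on the index `J₁ ⊕ J₂`) -/

section IMS

variable {E : Type*} {J₁ J₂ ι : Type*} [Fintype J₁] [Fintype J₂] [Fintype ι]

/-- **IMS FLOOR FROM THE COMMUTATOR LETTERS OF TWO FAMILIES, ERROR LETTER ADDITIVE**: two families `Φ¹, Φ²` of nonnegative functionals with
reference weights `w¹, w²` (`Σ_s w_s(j)² ≤ 1`) and commutator letters `Φ^i_j(loc_s x) ≤ |w^i_s(j)|·Φ^i_j(x) + ρ^i_{s,j}(x)`, error letters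
`Σ_j Σ_s ρ^i_{s,j}(x)² ≤ ε_i·N(x)` on `good`, `Σ_s N(loc_s x) = N(x)`, local floors `c_loc·N(loc_s x) ≤ Σ_jΦ¹_j(loc_s x)² + Σ_jΦ²_j(loc_s x)²` for `good x`,
and `Σ_jΦ¹_j(x)² + Σ_jΦ²_j(x)² ≤ F(x)` on `good` ⊢ `((c_loc − (1+t⁻¹)(ε₁ + ε₂))∕(1+t))·N(x) ≤ F(x)` for `good x`. [folklore] -/
theorem ims_floor_of_commutator_two (Φ₁ : J₁ → E → ℝ) (Φ₂ : J₂ → E → ℝ) (loc : ι → E → E)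
    (w₁ : ι → J₁ → ℝ) (w₂ : ι → J₂ → ℝ) (ρ₁ : ι → J₁ → E → ℝ) (ρ₂ : ι → J₂ → E → ℝ)
    (hw₁ : ∀ j, ∑ s, w₁ s j ^ 2 ≤ 1) (hw₂ : ∀ j, ∑ s, w₂ s j ^ 2 ≤ 1)
    (hΦ₁ : ∀ j y, 0 ≤ Φ₁ j y) (hΦ₂ : ∀ j y, 0 ≤ Φ₂ j y)
    (hcomm₁ : ∀ s j x, Φ₁ j (loc s x) ≤ |w₁ s j| * Φ₁ j x + ρ₁ s j x)
    (hcomm₂ : ∀ s j x, Φ₂ j (loc s x) ≤ |w₂ s j| * Φ₂ j x + ρ₂ s j x)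
    (N : E → ℝ) (good : E → Prop) {ε₁ ε₂ : ℝ}
    (hE₁ : ∀ x, good x → ∑ j, ∑ s, ρ₁ s j x ^ 2 ≤ ε₁ * N x)
    (hE₂ : ∀ x, good x → ∑ j, ∑ s, ρ₂ s j x ^ 2 ≤ ε₂ * N x)
    (hN : ∀ x, ∑ s, N (loc s x) = N x)
    {cloc : ℝ} (hloc : ∀ s x, good x → cloc * N (loc s x) ≤ ∑ j, Φ₁ j (loc s x) ^ 2 + ∑ j, Φ₂ j (loc s x) ^ 2)
    (F : E → ℝ) (hF : ∀ x, good x → ∑ j, Φ₁ j x ^ 2 + ∑ j, Φ₂ j x ^ 2 ≤ F x)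
    {t : ℝ} (ht : 0 < t) (x : E) (hx : good x) :
    (cloc - (1 + t⁻¹) * (ε₁ + ε₂)) / (1 + t) * N x ≤ F x := by
  refine ims_floor_of_commutator (Sum.elim Φ₁ Φ₂) loc (fun s => Sum.elim (w₁ s) (w₂ s))
    (fun s => Sum.elim (ρ₁ s) (ρ₂ s)) ?_ ?_ ?_ N good ?_ hN ?_ F ?_ ht x hx
  · rintro (j | j)
    · simpa only [Sum.elim_inl] using hw₁ j
    · simpa only [Sum.elim_inr] using hw₂ j
  · rintro (j | j) y
    · simpa only [Sum.elim_inl] using hΦ₁ j y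
    · simpa only [Sum.elim_inr] using hΦ₂ j y
  · rintro s (j | j) y
    · simpa only [Sum.elim_inl] using hcomm₁ s j y
    · simpa only [Sum.elim_inr] using hcomm₂ s j y
  · intro y hy
    rw [Fintype.sum_sum_type]
    simp only [Sum.elim_inl, Sum.elim_inr]
    have h1 := hE₁ y hy
    have h2 := hE₂ y hy
    linarith
  · intro s y hy
    rw [Fintype.sum_sum_type]
    simpa only [Sum.elim_inl, Sum.elim_inr] using hloc s y hy
  · intro y hy
    rw [Fintype.sum_sum_type]
    simpa only [Sum.elim_inl, Sum.elim_inr] using hF y hy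

/-- the same with the local floors stated for the FIRST family alone, `c_loc·N(loc_s x) ≤ Σ_jΦ¹_j(loc_s x)²` — the second family is nonnegative, so the
two-family local floor follows (bookkeeping convenience; in the lattice instance the local floor needs both families, use `ims_floor_of_commutator_two`).
[folklore] -/
theorem ims_floor_of_commutator_two_of_left (Φ₁ : J₁ → E → ℝ) (Φ₂ : J₂ → E → ℝ) (loc : ι → E → E)
    (w₁ : ι → J₁ → ℝ) (w₂ : ι → J₂ → ℝ) (ρ₁ : ι → J₁ → E → ℝ) (ρ₂ : ι → J₂ → E → ℝ)
    (hw₁ : ∀ j, ∑ s, w₁ s j ^ 2 ≤ 1) (hw₂ : ∀ j, ∑ s, w₂ s j ^ 2 ≤ 1)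
    (hΦ₁ : ∀ j y, 0 ≤ Φ₁ j y) (hΦ₂ : ∀ j y, 0 ≤ Φ₂ j y)
    (hcomm₁ : ∀ s j x, Φ₁ j (loc s x) ≤ |w₁ s j| * Φ₁ j x + ρ₁ s j x)
    (hcomm₂ : ∀ s j x, Φ₂ j (loc s x) ≤ |w₂ s j| * Φ₂ j x + ρ₂ s j x)
    (N : E → ℝ) (good : E → Prop) {ε₁ ε₂ : ℝ}
    (hE₁ : ∀ x, good x → ∑ j, ∑ s, ρ₁ s j x ^ 2 ≤ ε₁ * N x)
    (hE₂ : ∀ x, good x → ∑ j, ∑ s, ρ₂ s j x ^ 2 ≤ ε₂ * N x)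
    (hN : ∀ x, ∑ s, N (loc s x) = N x)
    {cloc : ℝ} (hloc₁ : ∀ s x, good x → cloc * N (loc s x) ≤ ∑ j, Φ₁ j (loc s x) ^ 2)
    (F : E → ℝ) (hF : ∀ x, good x → ∑ j, Φ₁ j x ^ 2 + ∑ j, Φ₂ j x ^ 2 ≤ F x)
    {t : ℝ} (ht : 0 < t) (x : E) (hx : good x) :
    (cloc - (1 + t⁻¹) * (ε₁ + ε₂)) / (1 + t) * N x ≤ F x := by
  refine ims_floor_of_commutator_two Φ₁ Φ₂ loc w₁ w₂ ρ₁ ρ₂ hw₁ hw₂ hΦ₁ hΦ₂ hcomm₁ hcomm₂ N good hE₁ hE₂ hN ?_ F hF ht x hx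
  intro s y hy
  have h0 : 0 ≤ ∑ j, Φ₂ j (loc s y) ^ 2 := Finset.sum_nonneg fun j _ => sq_nonneg _
  have h1 := hloc₁ s y hy
  linarith

end IMS

/-! ## §2 The IMS floor for two families of linear local terms on bond fields -/

section Linear

variable {J₁ J₂ ι C : Type*} [Fintype J₁] [Fintype J₂] [Fintype ι] [Fintype C]
variable {W V₁ V₂ : Type*} [NormedAddCommGroup W] [NormedSpace ℝ W]
  [NormedAddCommGroup V₁] [NormedSpace ℝ V₁] [NormedAddCommGroup V₂] [NormedSpace ℝ V₂]

/-- **THE SEMINORM-IMS FLOOR FOR TWO FAMILIES OF LINEAR LOCAL TERMS** (AFST `ims_floor_of_linear_terms` with the error letter split per family):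
terms `T¹_j x = Σ_{c∈inc₁ j} R¹_{j,c}(x c)` (`‖R¹_{j,c}v‖ ≤ ℓ₁‖v‖`, values in `V₁`) and `T²_j x = Σ_{c∈inc₂ j} R²_{j,c}(x c)` (`‖R²_{j,c}v‖ ≤ ℓ₂‖v‖`, values in
`V₂`), ONE quadratic partition of unity `h` acting by scalars, read on each family with its own reference bonds `ref_i`, (Lip) `|h_s(c) − h_s(ref_i j)| ≤ λ_i` on
`inc_i j`, (mult) `≤ μ_i` cubes non-constant on a term, counts `#inc_i j ≤ a_i`, `#{j : c ∈ inc_i j} ≤ b_i`; local floors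
`c_loc·Σ_c‖h_s(c)•x(c)‖² ≤ Σ_j‖T¹_j(h_s•x)‖² + Σ_j‖T²_j(h_s•x)‖²` for `good x`, and `Σ_j‖T¹_j x‖² + Σ_j‖T²_j x‖² ≤ F x` on `good` ⊢
`((c_loc − (1+t⁻¹)·(μ₁ℓ₁²λ₁²a₁b₁ + μ₂ℓ₂²λ₂²a₂b₂))∕(1+t))·Σ_c‖x c‖² ≤ F x`. [folklore] -/
theorem ims_floor_of_linear_terms_two [DecidableEq C]
    (inc₁ : J₁ → Finset C) (R₁ : J₁ → C → W →ₗ[ℝ] V₁) {ℓ₁ : ℝ} (hR₁ : ∀ j c v, ‖R₁ j c v‖ ≤ ℓ₁ * ‖v‖)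
    (inc₂ : J₂ → Finset C) (R₂ : J₂ → C → W →ₗ[ℝ] V₂) {ℓ₂ : ℝ} (hR₂ : ∀ j c v, ‖R₂ j c v‖ ≤ ℓ₂ * ‖v‖)
    (h : ι → C → ℝ) (hpart : ∀ c, ∑ s, h s c ^ 2 = 1) (ref₁ : J₁ → C) (ref₂ : J₂ → C)
    {lam₁ lam₂ : ℝ} (hlam₁ : 0 ≤ lam₁) (hlam₂ : 0 ≤ lam₂)
    (hlip₁ : ∀ s j, ∀ c ∈ inc₁ j, |h s c - h s (ref₁ j)| ≤ lam₁)
    (hlip₂ : ∀ s j, ∀ c ∈ inc₂ j, |h s c - h s (ref₂ j)| ≤ lam₂)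
    {μ₁ a₁ b₁ μ₂ a₂ b₂ : ℕ}
    (hμ₁ : ∀ j, (Finset.univ.filter fun s => ∃ c ∈ inc₁ j, h s c ≠ h s (ref₁ j)).card ≤ μ₁)
    (ha₁ : ∀ j, (inc₁ j).card ≤ a₁) (hb₁ : ∀ c, (Finset.univ.filter fun j => c ∈ inc₁ j).card ≤ b₁)
    (hμ₂ : ∀ j, (Finset.univ.filter fun s => ∃ c ∈ inc₂ j, h s c ≠ h s (ref₂ j)).card ≤ μ₂)
    (ha₂ : ∀ j, (inc₂ j).card ≤ a₂) (hb₂ : ∀ c, (Finset.univ.filter fun j => c ∈ inc₂ j).card ≤ b₂)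
    (good : (C → W) → Prop) {cloc : ℝ}
    (hloc : ∀ s x, good x → cloc * ∑ c, ‖h s c • x c‖ ^ 2 ≤
      ∑ j, ‖∑ c ∈ inc₁ j, R₁ j c (h s c • x c)‖ ^ 2 + ∑ j, ‖∑ c ∈ inc₂ j, R₂ j c (h s c • x c)‖ ^ 2)
    (F : (C → W) → ℝ)
    (hF : ∀ x, good x → ∑ j, ‖∑ c ∈ inc₁ j, R₁ j c (x c)‖ ^ 2 + ∑ j, ‖∑ c ∈ inc₂ j, R₂ j c (x c)‖ ^ 2 ≤ F x)
    {t : ℝ} (ht : 0 < t) (x : C → W) (hx : good x) :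
    (cloc - (1 + t⁻¹) * (μ₁ * ℓ₁ ^ 2 * lam₁ ^ 2 * a₁ * b₁ + μ₂ * ℓ₂ ^ 2 * lam₂ ^ 2 * a₂ * b₂)) / (1 + t)
        * ∑ c, ‖x c‖ ^ 2 ≤ F x :=
  ims_floor_of_commutator_two
    (fun j (x : C → W) => ‖∑ c ∈ inc₁ j, R₁ j c (x c)‖) (fun j (x : C → W) => ‖∑ c ∈ inc₂ j, R₂ j c (x c)‖)
    (fun s x c => h s c • x c)
    (fun s j => h s (ref₁ j)) (fun s j => h s (ref₂ j))
    (fun s j x => ℓ₁ * ∑ c ∈ inc₁ j, |h s c - h s (ref₁ j)| * ‖x c‖)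
    (fun s j x => ℓ₂ * ∑ c ∈ inc₂ j, |h s c - h s (ref₂ j)| * ‖x c‖)
    (fun j => (hpart (ref₁ j)).le) (fun j => (hpart (ref₂ j)).le)
    (fun _ _ => norm_nonneg _) (fun _ _ => norm_nonneg _)
    (fun s j x => norm_term_cutoff_le inc₁ R₁ hR₁ h ref₁ x s j)
    (fun s j x => norm_term_cutoff_le inc₂ R₂ hR₂ h ref₂ x s j)
    (fun x => ∑ c, ‖x c‖ ^ 2) good
    (fun x _ => ims_error_of_letters inc₁ h ref₁ hlam₁ hlip₁ hμ₁ ha₁ hb₁ x)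
    (fun x _ => ims_error_of_letters inc₂ h ref₂ hlam₂ hlip₂ hμ₂ ha₂ hb₂ x)
    (sum_normSq_cutoff h hpart) hloc F hF ht x hx

/-! ## §3 … with the local floors produced per cube from the five letters -/

/-- **THE (h2) SLOT FOR TWO FAMILIES OF LINEAR LOCAL TERMS**: as `ims_floor_of_linear_terms_two`, the local floors now PRODUCED per cube `s` from a
local gauge `u_s : (C → W) → E′` into fields of size `N′_s` with (iso) `N′_s(u_s(h_s•x)) = Σ_c‖h_s(c)•x(c)‖²`, (cov)
`Σ_j‖T¹_j(h_s•x)‖² + Σ_j‖T²_j(h_s•x)‖² = F′_s(u_s(h_s•x))` (the FULL local form — curls and averages — read in the cube's gauge), (adm)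
`good x → good⁰_s(u_s(h_s•x))`, (pert) `F⁰_s Y∕2 − δN′_s Y ≤ F′_s Y` and (flat) `cN′_s Y ≤ F⁰_s Y` on `good⁰_s` ⊢
`∀ x, good x → ((c∕2 − δ − (1+t⁻¹)·(μ₁ℓ₁²λ₁²a₁b₁ + μ₂ℓ₂²λ₂²a₂b₂))∕(1+t))·Σ_c‖x c‖² ≤ F x`. [folklore] -/
theorem admissible_floor_linear_terms_two [DecidableEq C] {E' : Type*}
    (inc₁ : J₁ → Finset C) (R₁ : J₁ → C → W →ₗ[ℝ] V₁) {ℓ₁ : ℝ} (hR₁ : ∀ j c v, ‖R₁ j c v‖ ≤ ℓ₁ * ‖v‖)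
    (inc₂ : J₂ → Finset C) (R₂ : J₂ → C → W →ₗ[ℝ] V₂) {ℓ₂ : ℝ} (hR₂ : ∀ j c v, ‖R₂ j c v‖ ≤ ℓ₂ * ‖v‖)
    (h : ι → C → ℝ) (hpart : ∀ c, ∑ s, h s c ^ 2 = 1) (ref₁ : J₁ → C) (ref₂ : J₂ → C)
    {lam₁ lam₂ : ℝ} (hlam₁ : 0 ≤ lam₁) (hlam₂ : 0 ≤ lam₂)
    (hlip₁ : ∀ s j, ∀ c ∈ inc₁ j, |h s c - h s (ref₁ j)| ≤ lam₁)
    (hlip₂ : ∀ s j, ∀ c ∈ inc₂ j, |h s c - h s (ref₂ j)| ≤ lam₂)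
    {μ₁ a₁ b₁ μ₂ a₂ b₂ : ℕ}
    (hμ₁ : ∀ j, (Finset.univ.filter fun s => ∃ c ∈ inc₁ j, h s c ≠ h s (ref₁ j)).card ≤ μ₁)
    (ha₁ : ∀ j, (inc₁ j).card ≤ a₁) (hb₁ : ∀ c, (Finset.univ.filter fun j => c ∈ inc₁ j).card ≤ b₁)
    (hμ₂ : ∀ j, (Finset.univ.filter fun s => ∃ c ∈ inc₂ j, h s c ≠ h s (ref₂ j)).card ≤ μ₂)
    (ha₂ : ∀ j, (inc₂ j).card ≤ a₂) (hb₂ : ∀ c, (Finset.univ.filter fun j => c ∈ inc₂ j).card ≤ b₂)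
    (good : (C → W) → Prop) {c δ : ℝ}
    (u : ι → (C → W) → E') (N' : ι → E' → ℝ) (F' F0 : ι → E' → ℝ) (good0 : ι → E' → Prop)
    (hiso : ∀ s x, good x → N' s (u s fun c' => h s c' • x c') = ∑ c', ‖h s c' • x c'‖ ^ 2)
    (hcov : ∀ s x, good x →
      ∑ j, ‖∑ c' ∈ inc₁ j, R₁ j c' (h s c' • x c')‖ ^ 2 + ∑ j, ‖∑ c' ∈ inc₂ j, R₂ j c' (h s c' • x c')‖ ^ 2
        = F' s (u s fun c' => h s c' • x c'))
    (hadm : ∀ s x, good x → good0 s (u s fun c' => h s c' • x c'))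
    (hpert : ∀ s Y, good0 s Y → F0 s Y / 2 - δ * N' s Y ≤ F' s Y)
    (hflat : ∀ s Y, good0 s Y → c * N' s Y ≤ F0 s Y)
    (F : (C → W) → ℝ)
    (hF : ∀ x, good x → ∑ j, ‖∑ c' ∈ inc₁ j, R₁ j c' (x c')‖ ^ 2 + ∑ j, ‖∑ c' ∈ inc₂ j, R₂ j c' (x c')‖ ^ 2 ≤ F x)
    {t : ℝ} (ht : 0 < t) :
    ∀ x : C → W, good x →
      (c / 2 - δ - (1 + t⁻¹) * (μ₁ * ℓ₁ ^ 2 * lam₁ ^ 2 * a₁ * b₁ + μ₂ * ℓ₂ ^ 2 * lam₂ ^ 2 * a₂ * b₂)) / (1 + t)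
        * ∑ c', ‖x c'‖ ^ 2 ≤ F x := by
  intro x hx
  have hloc : ∀ s x, good x → (c / 2 - δ) * ∑ c', ‖h s c' • x c'‖ ^ 2 ≤
      ∑ j, ‖∑ c' ∈ inc₁ j, R₁ j c' (h s c' • x c')‖ ^ 2 + ∑ j, ‖∑ c' ∈ inc₂ j, R₂ j c' (h s c' • x c')‖ ^ 2 := by
    intro s x hx
    rw [hcov s x hx, ← hiso s x hx]
    have h1 := hflat s _ (hadm s x hx)
    have h2 := hpert s _ (hadm s x hx)
    linarith
  exact ims_floor_of_linear_terms_two inc₁ R₁ hR₁ inc₂ R₂ hR₂ h hpart ref₁ ref₂ hlam₁ hlam₂ hlip₁ hlip₂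
    hμ₁ ha₁ hb₁ hμ₂ ha₂ hb₂ good hloc F hF ht x hx

/-! ## §4 Consistency: AFST's one-family floor is the case of an empty second family -/

omit [Fintype J₂] [NormedAddCommGroup V₂] [NormedSpace ℝ V₂] in
/- AFST `ims_floor_of_linear_terms` RECOVERED from §2 with `J₂ := Empty` (no second family; its counts `μ₂ = a₂ = b₂ = 0`, `ℓ₂ = λ₂ = 0`) — a
consistency check that the two-family statement specialises to the one in the tree, letter for letter; an `example`, so that no DECLARATION restates
the tree's theorem (chair leaf-04 g161, R1: gate `dedup.landed`). [folklore] -/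
example [DecidableEq C] (inc : J₁ → Finset C) (R : J₁ → C → W →ₗ[ℝ] V₁) {ℓ : ℝ}
    (hR : ∀ j c v, ‖R j c v‖ ≤ ℓ * ‖v‖)
    (h : ι → C → ℝ) (hpart : ∀ c, ∑ s, h s c ^ 2 = 1) (ref : J₁ → C)
    {lam : ℝ} (hlam : 0 ≤ lam) (hlip : ∀ s j, ∀ c ∈ inc j, |h s c - h s (ref j)| ≤ lam)
    {μ a b : ℕ} (hμ : ∀ j, (Finset.univ.filter fun s => ∃ c ∈ inc j, h s c ≠ h s (ref j)).card ≤ μ)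
    (ha : ∀ j, (inc j).card ≤ a) (hb : ∀ c, (Finset.univ.filter fun j => c ∈ inc j).card ≤ b)
    (good : (C → W) → Prop) {cloc : ℝ}
    (hloc : ∀ s x, good x → cloc * ∑ c, ‖h s c • x c‖ ^ 2 ≤ ∑ j, ‖∑ c ∈ inc j, R j c (h s c • x c)‖ ^ 2)
    (F : (C → W) → ℝ) (hF : ∀ x, good x → ∑ j, ‖∑ c ∈ inc j, R j c (x c)‖ ^ 2 ≤ F x)
    {t : ℝ} (ht : 0 < t) (x : C → W) (hx : good x) :
    (cloc - (1 + t⁻¹) * (μ * ℓ ^ 2 * lam ^ 2 * a * b)) / (1 + t) * ∑ c, ‖x c‖ ^ 2 ≤ F x := by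
  have key := ims_floor_of_linear_terms_two (J₂ := Empty) (V₂ := V₁) inc R hR
    (fun j => Empty.elim j) (fun j => Empty.elim j) (ℓ₂ := 0) (fun j => Empty.elim j)
    h hpart ref (fun j => Empty.elim j) hlam (lam₂ := 0) le_rfl hlip (fun _ j => Empty.elim j)
    (μ₂ := 0) (a₂ := 0) (b₂ := 0) hμ ha hb (fun j => Empty.elim j) (fun j => Empty.elim j)
    (fun c => by simp) good (cloc := cloc)
    (fun s y hy => by simpa using hloc s y hy) F (fun y hy => by simpa using hF y hy) ht x hx
  simp only [Nat.cast_zero, zero_mul, mul_zero, add_zero] at key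
  exact key

/-! ## §5 Toy: two one-term families on one bond, `R = id` on `ℝ`, `h ≡ 1` -/

section Toy

/- `J₁ = J₂ = ι = C = Unit`, `W = V₁ = V₂ = ℝ`, `inc_i _ = {()}`, `R^i = id` (`ℓ_i = 1`), `h ≡ 1` (`λ_i = 0`, `μ_i = 1`), `a_i = b_i = 1`, `good = True`,
`c_loc = 2` (the two local terms give `2‖x‖²`), `F x = ‖x ()‖² + ‖x ()‖²`, `t = 1`: the floor `((2 − 2·(0 + 0))∕2)·‖x ()‖² ≤ ‖x ()‖² + ‖x ()‖²`. -/
example (x : Unit → ℝ) :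
    (2 - (1 + (1 : ℝ)⁻¹) * (((1 : ℕ) * (1 : ℝ) ^ 2 * (0 : ℝ) ^ 2 * (1 : ℕ) * (1 : ℕ))
      + ((1 : ℕ) * (1 : ℝ) ^ 2 * (0 : ℝ) ^ 2 * (1 : ℕ) * (1 : ℕ)))) / (1 + 1) * ∑ c, ‖x c‖ ^ 2
      ≤ ∑ c, ‖x c‖ ^ 2 + ∑ c, ‖x c‖ ^ 2 := by
  have key := ims_floor_of_linear_terms_two (J₁ := Unit) (J₂ := Unit) (ι := Unit) (C := Unit) (W := ℝ) (V₁ := ℝ) (V₂ := ℝ)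
    (fun _ => {()}) (fun _ _ => LinearMap.id) (ℓ₁ := 1) (fun _ _ v => by simp)
    (fun _ => {()}) (fun _ _ => LinearMap.id) (ℓ₂ := 1) (fun _ _ v => by simp)
    (fun _ _ => (1 : ℝ)) (fun _ => by simp) (fun _ => ()) (fun _ => ()) (lam₁ := 0) (lam₂ := 0) le_rfl le_rfl
    (fun _ _ _ _ => by simp) (fun _ _ _ _ => by simp)
    (μ₁ := 1) (a₁ := 1) (b₁ := 1) (μ₂ := 1) (a₂ := 1) (b₂ := 1)
    (fun _ => by simp) (fun _ => by simp) (fun _ => by simp) (fun _ => by simp) (fun _ => by simp) (fun _ => by simp)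
    (fun _ => True) (cloc := 2) (fun _ y _ => by simp [two_mul]) (fun y => ∑ c, ‖y c‖ ^ 2 + ∑ c, ‖y c‖ ^ 2)
    (fun y _ => by simp) one_pos x trivial
  simpa using key

end Toy

end Linear

/-! ## §6 (v1.2, appended) `gamma0_assembly` BY NAME with (h2) supplied by the two-family floor — AFSI §6's junction for the full form -/

section Assembly

open Matrix
open Literature.MathematicalPhysics.QuantumFieldTheory.Balaban1983to89.B9SectEKernel (gamma0_assembly)

variable {n m : Type*} [Fintype n] [Fintype m] [DecidableEq m] {J₁ J₂ ι : Type*} [Fintype J₁] [Fintype J₂] [Fintype ι]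

/-- **PRINT's `γ₀′` WITH (h2) SUPPLIED BY THE TWO-FAMILY SEMINORM FLOOR** (AFSI §6 `gamma0_assembly_of_seminorm_ims` for the full form's two families):
`B9SectEKernel.gamma0_assembly`'s data and hypotheses VERBATIM except `h2`, which is replaced by §1's two-family data on `E = (m → ℝ)` with `N = (· ⬝ᵥ ·)` and
`loc_s x = h_s * x` for a quadratic partition of unity `{h_s}` (`Σ_s h_s(i)² = 1`): families `Φ¹, Φ²` (`≥ 0`) with reference weights `w¹, w²` (`Σ_s w_s(j)² ≤ 1`),
commutator letters, error letters `ε₁, ε₂`, local floors `c_loc·‖h_s·x‖² ≤ ΣΦ¹(h_s·x)² + ΣΦ²(h_s·x)²` on `good`, `ΣΦ¹² + ΣΦ²² ≤ F` on `good`; conclusion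
`(((c_loc − (1+t⁻¹)(ε₁ + ε₂))∕(1+t) − κ₂)∕κ₁ − θ)‖B‖² ≤ ⟨B, (P − a − 𝒥)B⟩` for admissible `B`. [folklore] -/
theorem gamma0_assembly_of_seminorm_ims_two (K : Matrix n n ℝ) (Q : Matrix m n ℝ) (a : ℝ) (H : Matrix n m ℝ) (P Jm : Matrix m m ℝ)
    (hQH : Q * H = 1) (hSH : (K + a • (Qᵀ * Q)) * H = Qᵀ * P) (good : (m → ℝ) → Prop)
    (F : (m → ℝ) → ℝ) {κ₁ κ₂ θ : ℝ} (hκ₁ : 0 < κ₁)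
    (h1 : ∀ A : n → ℝ, F (Q *ᵥ A) ≤ κ₁ * (A ⬝ᵥ (K *ᵥ A)) + κ₂ * ((Q *ᵥ A) ⬝ᵥ (Q *ᵥ A)))
    (hJ : ∀ B : m → ℝ, |B ⬝ᵥ (Jm *ᵥ B)| ≤ θ * (B ⬝ᵥ B))
    -- the two-family (h2) data of §1 in the `⬝ᵥ` currency
    (h : ι → m → ℝ) (hpart : ∀ i, ∑ s, h s i ^ 2 = 1)
    (Φ₁ : J₁ → (m → ℝ) → ℝ) (Φ₂ : J₂ → (m → ℝ) → ℝ) (w₁ : ι → J₁ → ℝ) (w₂ : ι → J₂ → ℝ)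
    (ρ₁ : ι → J₁ → (m → ℝ) → ℝ) (ρ₂ : ι → J₂ → (m → ℝ) → ℝ)
    (hw₁ : ∀ j, ∑ s, w₁ s j ^ 2 ≤ 1) (hw₂ : ∀ j, ∑ s, w₂ s j ^ 2 ≤ 1)
    (hΦ₁ : ∀ j y, 0 ≤ Φ₁ j y) (hΦ₂ : ∀ j y, 0 ≤ Φ₂ j y)
    (hcomm₁ : ∀ s j x, Φ₁ j (h s * x) ≤ |w₁ s j| * Φ₁ j x + ρ₁ s j x)
    (hcomm₂ : ∀ s j x, Φ₂ j (h s * x) ≤ |w₂ s j| * Φ₂ j x + ρ₂ s j x)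
    {ε₁ ε₂ : ℝ} (hE₁ : ∀ x, good x → ∑ j, ∑ s, ρ₁ s j x ^ 2 ≤ ε₁ * (x ⬝ᵥ x))
    (hE₂ : ∀ x, good x → ∑ j, ∑ s, ρ₂ s j x ^ 2 ≤ ε₂ * (x ⬝ᵥ x))
    {cloc : ℝ} (hloc : ∀ s x, good x → cloc * ((h s * x) ⬝ᵥ (h s * x)) ≤ ∑ j, Φ₁ j (h s * x) ^ 2 + ∑ j, Φ₂ j (h s * x) ^ 2)
    (hF : ∀ x, good x → ∑ j, Φ₁ j x ^ 2 + ∑ j, Φ₂ j x ^ 2 ≤ F x) {t : ℝ} (ht : 0 < t)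
    (B : m → ℝ) (hB : good B) :
    (((cloc - (1 + t⁻¹) * (ε₁ + ε₂)) / (1 + t) - κ₂) / κ₁ - θ) * (B ⬝ᵥ B) ≤ B ⬝ᵥ ((P - a • (1 : Matrix m m ℝ) - Jm) *ᵥ B) := by
  -- (part): a quadratic partition of unity splits `⬝ᵥ` (as AFSI §6, re-derived inline)
  have hN : ∀ x : m → ℝ, ∑ s, (h s * x) ⬝ᵥ (h s * x) = x ⬝ᵥ x := by
    intro x
    simp only [dotProduct, Pi.mul_apply]
    rw [Finset.sum_comm]
    refine Finset.sum_congr rfl fun i _ => ?_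
    have e : ∀ s, h s i * x i * (h s i * x i) = h s i ^ 2 * (x i * x i) := fun s => by ring
    simp_rw [e]
    rw [← Finset.sum_mul, hpart i, one_mul]
  exact gamma0_assembly K Q a H P Jm hQH hSH good F hκ₁ h1
    (fun x hx => ims_floor_of_commutator_two Φ₁ Φ₂ (fun s x => h s * x) w₁ w₂ ρ₁ ρ₂ hw₁ hw₂ hΦ₁ hΦ₂ hcomm₁ hcomm₂
      (fun x => x ⬝ᵥ x) good hE₁ hE₂ hN hloc F hF ht x hx) hJ B hB

end Assembly

end Summit.QuantumFields.BalabanUV.T4Continuum.NE7b.AdmissibleFloorSeminormTwoFamilies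

end
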